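import Literature.NumberTheory.DiophantineGeometry.ShuteFourSquareful

/-!
# Shute (2021), §3: the auxiliary count `L(X, Y)` of the printed proof of Prop. 3.2 is `≥ 4X²`

Seventh companion to `ShuteFourSquareful.lean`. The named fact `Shute2021_prop32` (= Shute's
Prop. 3.2) is recorded there as a CLAIM because the printed proof of the fourth-moment bound
`N(X, Y) = O(X^{2+ε}Y^{8/3+ε})` behind it is incomplete (module docstring of
`ShuteFourSquareful.lean`, section **Status**). This file makes the defect kernel-checked.

The printed proof (arXiv §3, (3.4)–(3.6) and the last display of §3; thesis (6.3.4)–(6.3.6) and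
p. 84) bounds `|S(α)|²` pointwise by Cauchy–Schwarz in `x` and in `y`, integrates, obtains
`N(X, Y) ≤ XY · L'(X, Y)` with

  `L'(X, Y) = #{(x, x₁, x₂, y, y₁, y₂) ∈ (ℤ_{≠0})⁶ : |x|, |x₁|, |x₂| ≤ X, |y|, |y₁|, |y₂| ≤ Y,`
  `            y, y₁, y₂ square-free, x²(y₁³ − y₂³) = y³(x₁² − x₂²)}`

(`Shute2021.printedL`, transcribed verbatim), and then asserts, after a dyadic decomposition
`L' = Σ_U L` in `|x| ∼ U` and the last display of §3,

  `L'(X, Y) ≪_ε X^{1+ε} Y^{5/3+ε}`            (∗)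

("we take a sum over `k ≤ Y` and dyadic intervals `U ≤ 2X` to obtain `L(X,Y) ≪ X^{1+ε}Y^{5/3+ε}`.
Recalling `N ≤ XY L'`, we have established `N(X,Y) = O(X^{2+ε}Y^{8/3+ε})`"). The two counting
bounds feeding (∗) both use `x₁ ≠ ±x₂` ("the cases `x₁ = ±x₂` have already been dealt with
above", "`u ≠ 0` by the assumption `x₁ ≠ ±x₂`"), an exclusion that was made for the variables of
`N(X, Y)`, not for the new variables of `L'`. For `L'` as defined — and only the full `L'`
satisfies `N ≤ XY·L'` — (∗) is false: every tuple with `x₂ = x₁`, `y₂ = y₁` and `x, y` free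
belongs to `L'`, whence

* `Shute2021.four_mul_sq_mul_sq_le_printedL`: `4X² · Q(Y)² ≤ L'(X, Y)` for all `X, Y`, where
  `Q(Y) = #{1 ≤ y ≤ Y square-free}` (`Shute2021.sqfreeIcc`); in particular
  `Shute2021.four_mul_sq_le_printedL`: `4X² ≤ L'(X, Y)` for `Y ≥ 1`;
* `Shute2021.printedL_gt`: for every `ε < 1` and every `C` there are `X, Y ≥ 1` with
  `L'(X, Y) > C X^{1+ε} Y^{5/3+ε}` (already with `Y = 1`);
* `Shute2021.not_printedL_le`: the negation of (∗) in the `∀ ε > 0, ∃ C, ∀ X, Y ≥ 1` form used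
  throughout `ShuteFourSquareful*.lean`.

So the printed chain proves nothing beyond `N(X, Y) ≤ XY·L'(X, Y)` with `XY·L' ≥ 4X³Y`, weaker
than the trivial bound; what the method does give (exponent `3`, resp. the range `X³ ≤ Y²`) is
proved in `ShuteFourSquarefulMoment.lean`, `ShuteFourSquarefulXColour.lean`,
`ShuteFourSquarefulShortX.lean`. Nothing here bears on the truth of Prop. 3.2 itself
(heuristically `N(X, Y) ≍ X²Y²`); it pins down why the source does not prove it.

## References

* A. Shute, *Sums of four squareful numbers*, arXiv:2104.06966v1 [math.NT] (2021), §3, proof of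
  Prop. 3.2: the definition of `L'(X, Y)` after (3.6) `N(X,Y) ≤ XYL'(X,Y)`, and the final display
  `L(X, Y) ≪ X^{1+ε}Y^{5/3+ε}` (PDF p. 10). [Shute2021]
* A. L. Shute, PhD thesis, ISTA (2022), doi:10.15479/at:ista:12072, §6.3, (6.3.6) and p. 84
  (identical text). [Shute2022thesis]
-/

noncomputable section

open Finset

namespace Literature.NumberTheory.DiophantineGeometry

namespace Shute2021

/-! ### The count `L'(X, Y)` -/

/-- The box `{𝐯 ∈ ℤ³ : |vᵢ| ≤ X}` as a `Finset (Fin 3 → ℤ)`. [folklore] -/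
def box₃ (X : ℕ) : Finset (Fin 3 → ℤ) :=
  Fintype.piFinset fun _ => Icc (-(X : ℤ)) X

/-- Membership in `box₃ X`: `|vᵢ| ≤ X` for all `i`. [folklore] -/
theorem mem_box₃ {X : ℕ} {v : Fin 3 → ℤ} : v ∈ box₃ X ↔ ∀ i, |v i| ≤ X := by
  simp [box₃, Fintype.mem_piFinset, abs_le]

/-- Shute's `L'(X, Y)` (§3, proof of Prop. 3.2, after (3.6)): the number of
`(x, x₁, x₂, y, y₁, y₂) ∈ (ℤ_{≠0})⁶` with `|x|, |x₁|, |x₂| ≤ X`, `|y|, |y₁|, |y₂| ≤ Y`,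
`y, y₁, y₂` square-free and `x²(y₁³ − y₂³) = y³(x₁² − x₂²)`. Coordinates: `p.1 = (x, x₁, x₂)`,
`p.2 = (y, y₁, y₂)`. (The paper's `L(X, Y)` is the same count with `U/2 < |x| ≤ U`, summed over
dyadic `U ≤ 2X` at the end, i.e. `L'`.) [cite: Shute2021, §3, proof of Prop. 3.2, def. of L'(X,Y)] -/
def printedL (X Y : ℕ) : ℕ :=
  #{p ∈ box₃ X ×ˢ box₃ Y |
      (∀ i, p.1 i ≠ 0 ∧ p.2 i ≠ 0 ∧ Squarefree (p.2 i).natAbs) ∧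
        p.1 0 ^ 2 * (p.2 1 ^ 3 - p.2 2 ^ 3) = p.2 0 ^ 3 * (p.1 1 ^ 2 - p.1 2 ^ 2)}

/-- The positive square-free integers `1 ≤ y ≤ Y`, as integers; `Q(Y)` is its cardinality.
[folklore] -/
def sqfreeIcc (Y : ℕ) : Finset ℤ := {y ∈ Icc (1 : ℤ) Y | Squarefree y.natAbs}

/-- `1 ∈ sqfreeIcc Y` for `Y ≥ 1`. [folklore] -/
theorem one_mem_sqfreeIcc {Y : ℕ} (hY : 1 ≤ Y) : (1 : ℤ) ∈ sqfreeIcc Y := by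
  unfold sqfreeIcc
  rw [mem_filter, mem_Icc]
  exact ⟨⟨le_rfl, by exact_mod_cast hY⟩, by simp⟩

/-- `Q(Y) ≥ 1` for `Y ≥ 1`. [folklore] -/
theorem one_le_card_sqfreeIcc {Y : ℕ} (hY : 1 ≤ Y) : 1 ≤ #(sqfreeIcc Y) :=
  card_pos.2 ⟨1, one_mem_sqfreeIcc hY⟩

/-- The nonzero integers `0 < |x| ≤ X` number `2X`. [folklore] -/
theorem card_Icc_erase_zero (X : ℕ) : #((Icc (-(X : ℤ)) X).erase 0) = 2 * X := by
  rw [card_erase_of_mem (by simp), Int.card_Icc,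
    show (X : ℤ) + 1 - -(X : ℤ) = ((2 * X + 1 : ℕ) : ℤ) by push_cast; ring, Int.toNat_natCast]
  omega

/-- The diagonal family of the gap: `(x, x₁, y, y₁) ↦ (x, x₁, x₁; y, y₁, y₁)` lands in the set
counted by `L'(X, Y)` (the equation reads `x² · 0 = y³ · 0`). [folklore] -/
def diagTuple (q : (ℤ × ℤ) × (ℤ × ℤ)) : (Fin 3 → ℤ) × (Fin 3 → ℤ) :=
  (![q.1.1, q.1.2, q.1.2], ![q.2.1, q.2.2, q.2.2])

/-- **The diagonal of `L'`.** `4X² · Q(Y)² ≤ L'(X, Y)`: the `2X · 2X · Q(Y) · Q(Y)` tuples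
`(x, x₁, x₁, y, y₁, y₁)` with `0 < |x|, |x₁| ≤ X` and `1 ≤ y, y₁ ≤ Y` square-free all belong to
`L'(X, Y)`. (With both signs of `y, y₁` and `x₂ = ±x₁` one gets `32X²Q(Y)²`; `4X²Q(Y)²` suffices.)
[folklore] -/
theorem four_mul_sq_mul_sq_le_printedL (X Y : ℕ) :
    4 * X ^ 2 * #(sqfreeIcc Y) ^ 2 ≤ printedL X Y := by
  classical
  set I : Finset ℤ := (Icc (-(X : ℤ)) X).erase 0 with hI
  have hcard : #((I ×ˢ I) ×ˢ (sqfreeIcc Y ×ˢ sqfreeIcc Y)) = 4 * X ^ 2 * #(sqfreeIcc Y) ^ 2 := by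
    rw [card_product, card_product, card_product, hI, card_Icc_erase_zero]
    ring
  rw [← hcard]
  unfold printedL
  refine card_le_card_of_injOn diagTuple ?_ ?_
  · intro q hq
    rw [mem_coe, mem_product, mem_product, mem_product] at hq
    obtain ⟨⟨hu, hv⟩, hw, hz⟩ := hq
    rw [hI, mem_erase, mem_Icc] at hu hv
    unfold sqfreeIcc at hw hz
    rw [mem_filter, mem_Icc] at hw hz
    rw [mem_coe, mem_filter, mem_product, mem_box₃, mem_box₃]
    refine ⟨⟨?_, ?_⟩, ?_, ?_⟩
    · intro i
      fin_cases i
      exacts [abs_le.2 hu.2, abs_le.2 hv.2, abs_le.2 hv.2]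
    · have hw' : |q.2.1| ≤ (Y : ℤ) := abs_le.2 ⟨by linarith [hw.1.1], hw.1.2⟩
      have hz' : |q.2.2| ≤ (Y : ℤ) := abs_le.2 ⟨by linarith [hz.1.1], hz.1.2⟩
      intro i
      fin_cases i
      exacts [hw', hz', hz']
    · have hw0 : q.2.1 ≠ 0 := by have := hw.1.1; omega
      have hz0 : q.2.2 ≠ 0 := by have := hz.1.1; omega
      intro i
      fin_cases i
      exacts [⟨hu.1, hw0, hw.2⟩, ⟨hv.1, hz0, hz.2⟩, ⟨hv.1, hz0, hz.2⟩]
    · simp only [diagTuple, Matrix.cons_val_zero, Matrix.cons_val_one, Matrix.cons_val]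
      ring
  · intro q _ q' _ hqq'
    have h1 : ∀ i, (diagTuple q).1 i = (diagTuple q').1 i := fun i => by rw [hqq']
    have h2 : ∀ i, (diagTuple q).2 i = (diagTuple q').2 i := fun i => by rw [hqq']
    have a := h1 0; have b := h1 1; have c := h2 0; have d := h2 1
    simp only [diagTuple, Matrix.cons_val_zero, Matrix.cons_val_one] at a b c d
    exact Prod.ext (Prod.ext a b) (Prod.ext c d)

/-- `4X² ≤ L'(X, Y)` for all `X` and all `Y ≥ 1`. [folklore] -/
theorem four_mul_sq_le_printedL (X : ℕ) {Y : ℕ} (hY : 1 ≤ Y) : 4 * X ^ 2 ≤ printedL X Y :=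
  le_trans (by simpa using Nat.mul_le_mul_left (4 * X ^ 2) (Nat.one_le_pow 2 _ (one_le_card_sqfreeIcc hY)))
    (four_mul_sq_mul_sq_le_printedL X Y)

/-! ### The printed bound `L'(X, Y) ≪ X^{1+ε}Y^{5/3+ε}` fails -/

/-- **The last display of the printed proof of Prop. 3.2 is false as stated.** For every exponent
`ε < 1` and every constant `C` there are `X, Y ≥ 1` (indeed `Y = 1`) with
`L'(X, Y) > C · X^{1+ε} · Y^{5/3+ε}`; the source asserts `L'(X, Y) ≪_ε X^{1+ε}Y^{5/3+ε}` for every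
`ε > 0`. [cite: Shute2021, §3, proof of Prop. 3.2, last display (refuted as stated)] -/
theorem printedL_gt {ε : ℝ} (hε : ε < 1) (C : ℝ) :
    ∃ X Y : ℕ, 1 ≤ X ∧ 1 ≤ Y ∧
      C * (X : ℝ) ^ (1 + ε) * (Y : ℝ) ^ (5 / 3 + ε) < printedL X Y := by
  -- choose `X` with `X^{1-ε} > C`: `X = ⌈(max C 1)^{1/(1-ε)}⌉₊ + 1`
  have h1ε : 0 < 1 - ε := by linarith
  set M : ℝ := max C 1 with hM
  have hM1 : 1 ≤ M := le_max_right _ _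
  have hM0 : 0 < M := by linarith
  set X : ℕ := ⌈M ^ (1 / (1 - ε))⌉₊ + 1 with hX
  have hX1 : 1 ≤ X := Nat.le_add_left 1 _
  have hXpos : (0 : ℝ) < X := by exact_mod_cast hX1
  have hXgt : M ^ (1 / (1 - ε)) < (X : ℝ) := by
    have := Nat.le_ceil (M ^ (1 / (1 - ε)))
    rw [hX]
    push_cast
    linarith
  -- hence `M < X^{1-ε}`
  have hMX : M < (X : ℝ) ^ (1 - ε) := by
    have h := Real.rpow_lt_rpow (by positivity) hXgt h1ε
    rwa [← Real.rpow_mul hM0.le, one_div_mul_cancel h1ε.ne', Real.rpow_one] at h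
  refine ⟨X, 1, hX1, le_rfl, ?_⟩
  have hL : (4 * (X : ℝ) ^ 2 : ℝ) ≤ printedL X 1 := by
    exact_mod_cast four_mul_sq_le_printedL X le_rfl
  refine lt_of_lt_of_le ?_ hL
  rw [Nat.cast_one, Real.one_rpow, mul_one]
  -- `C X^{1+ε} ≤ M X^{1+ε} < X^{1-ε} X^{1+ε} = X² ≤ 4 X²`
  have hsplit : (X : ℝ) ^ (1 - ε) * (X : ℝ) ^ (1 + ε) = (X : ℝ) ^ 2 := by
    rw [← Real.rpow_add hXpos, show (1 - ε) + (1 + ε) = ((2 : ℕ) : ℝ) by norm_num,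
      Real.rpow_natCast]
  have hpow : 0 < (X : ℝ) ^ (1 + ε) := Real.rpow_pos_of_pos hXpos _
  calc C * (X : ℝ) ^ (1 + ε) ≤ M * (X : ℝ) ^ (1 + ε) :=
        mul_le_mul_of_nonneg_right (le_max_left _ _) hpow.le
    _ < (X : ℝ) ^ (1 - ε) * (X : ℝ) ^ (1 + ε) := mul_lt_mul_of_pos_right hMX hpow
    _ = (X : ℝ) ^ 2 := hsplit
    _ ≤ 4 * (X : ℝ) ^ 2 := by nlinarith [sq_nonneg (X : ℝ)]

/-- **Negation of the printed bound** in the `∀ ε > 0, ∃ C` form: it is NOT the case that for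
every `ε > 0` there is `C` with `L'(X, Y) ≤ C X^{1+ε} Y^{5/3+ε}` for all `X, Y ≥ 1` (take
`ε = 1/2` in `printedL_gt`). This is the step of the printed proof of Prop. 3.2 that fails; the
statement of Prop. 3.2 (`Shute2021_prop32`) is not affected.
[cite: Shute2021, §3, proof of Prop. 3.2, last display (refuted as stated)] -/
theorem not_printedL_le :
    ¬ ∀ ε : ℝ, 0 < ε → ∃ C : ℝ, ∀ X Y : ℕ, 1 ≤ X → 1 ≤ Y →
        (printedL X Y : ℝ) ≤ C * (X : ℝ) ^ (1 + ε) * (Y : ℝ) ^ (5 / 3 + ε) := by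
  intro h
  obtain ⟨C, hC⟩ := h (1 / 2) one_half_pos
  obtain ⟨X, Y, hX, hY, hlt⟩ := printedL_gt (show (1 / 2 : ℝ) < 1 by norm_num) C
  exact absurd (hC X Y hX hY) (not_le.2 hlt)

end Shute2021

end Literature.NumberTheory.DiophantineGeometry
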